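import Literature.AlgebraicGeometry.Resolution.AffineBlowupCartier
import Literature.AlgebraicGeometry.Resolution.AffineBlowupReductionCover
import HarnessLib

/-!
# Crux `FrobeniusLadder.FRationalResolution` (stmt-ResolutionOfSingularities-15317), line `redirect`,
# stub `stub_diagonalizableQuotientResolution` — an ideal is CARTIER on an affine blow-up as soon as it becomes principal,
# generated by a nonzerodivisor, on the Rees charts at a reduction of the centre

Companion of `…BlowupAbsorbsCartier` (the blow-up of `J` is the blow-up of `J · ∏ Jᵢ` once every `J̃ᵢ` is Cartier on it)
and of the symmetrized piece of the Galois route (`…GaloisSymmetrizedPiece`): the Cartier hypothesis is CHARTWISE. For the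
affine blowing up `π : Bl_I(Spec R) = Proj R[It] → Spec R` of the tree (`Literature…AffineBlowup`) and elements `xᵢ ∈ I`
generating a reduction of `I` (`I^{N+1} ⊆ (xᵢ) I^N`, e.g. generators with `N = 0`), the charts `D₊(xᵢ t) = Spec (R[It])_{(xᵢt)}`
cover the blowing up (`affineBlowup.iSup_basicOpen_reesT_eq_top_of_pow_le`); if the extension of an ideal `L ⊆ R` to every
chart ring `(R[It])_{(xᵢ t)}` (along `reesChartBase`) is principal and generated by a nonzerodivisor, then the inverse image
ideal sheaf `π⁻¹ L̃ · 𝒪` is an effective Cartier divisor — the proof of `affineBlowup.exists_nonZeroDivisor_exceptionalIdeal`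
(the case `L = I`) verbatim for a general `L`.

* `affineBlowup.comap_idealSheaf_comap_chartι` — `(π⁻¹ L̃)|_{D₊(bt)} = (L · (R[It])_{(bt)})~`;
* **`affineBlowup.isEffectiveCartier_comap_idealSheaf_of_charts`** — the chartwise criterion.

Honest label: plumbing toward ONE leaf stub (no stub, crux or summit closed). No definitions, no named facts, no sorry.
[cite: StacksProject, Tag 0804; Tag 02OS] [cite: GortzWedhorn2020, (13.19)]
-/

noncomputable section

-- single-problem summit: the doubled namespace component is forced
set_option linter.dupNamespace false

open CategoryTheory CategoryTheory.Limits AlgebraicGeometry TopologicalSpace Opposite HomogeneousLocalization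
open Literature.AlgebraicGeometry.Resolution

namespace Summit.ResolutionOfSingularities.ResolutionOfSingularities.Theorems.FRationalResolution.BlowupChartCartier

universe u

variable {R : Type u} [CommRing R] {I : Ideal R}

/-- **Chart formula for an inverse image ideal sheaf.** For `b ∈ I` and an ideal `L ⊆ R`, the pull-back of `π⁻¹ L̃ · 𝒪`
to the chart `Spec (R[It])_{(bt)}` is the ideal sheaf of `L · (R[It])_{(bt)}`. [cite: StacksProject, Tag 0804] -/
theorem affineBlowup.comap_idealSheaf_comap_chartι (b : R) (hb : b ∈ I) (L : Ideal R) :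
    ((affineBlowup.idealSheaf L).comap (affineBlowup.π I)).comap (affineBlowup.chartι b hb) =
      Scheme.IdealSheafData.ofIdealTop ((L.map (reesChartBase b hb)).map
        (Scheme.ΓSpecIso (.of (Away (reesGrading I) (reesT b hb)))).inv.hom) := by
  rw [← Scheme.IdealSheafData.comap_comp, affineBlowup.chartι_π, affineBlowup.idealSheaf]
  exact comap_ofIdealTop_SpecMap (reesChartBase b hb) L

/-- **Chartwise Cartier criterion on an affine blowing up.** Let `xᵢ ∈ I` generate a reduction of `I`
(`I^{N+1} ⊆ (xᵢ)·I^N`) and let `L ⊆ R` be an ideal whose extension to every chart ring `(R[It])_{(xᵢ t)}` is generated by a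
single nonzerodivisor. Then `π⁻¹ L̃ · 𝒪_{Bl_I(Spec R)}` is an effective Cartier divisor.
[cite: StacksProject, Tag 0804; Tag 02OS] [cite: GortzWedhorn2020, (13.19)] -/
theorem affineBlowup.isEffectiveCartier_comap_idealSheaf_of_charts {ι : Type*} (x : ι → R) (hxI : ∀ i, x i ∈ I)
    {N : ℕ} (hI : I ^ (N + 1) ≤ Ideal.span (Set.range x) * I ^ N) (L : Ideal R)
    (hL : ∀ i, ∃ ℓ : Away (reesGrading I) (reesT (x i) (hxI i)),
      ℓ ∈ nonZeroDivisors (Away (reesGrading I) (reesT (x i) (hxI i))) ∧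
        L.map (reesChartBase (x i) (hxI i)) = Ideal.span {ℓ}) :
    IsEffectiveCartier ((affineBlowup.idealSheaf L).comap (affineBlowup.π I)) := by
  intro p
  -- the point lies in some chart `D₊(xᵢ t)`
  have hp : p ∈ ⨆ i, Proj.basicOpen (reesGrading I) (reesT (x i) (hxI i)) := by
    rw [affineBlowup.iSup_basicOpen_reesT_eq_top_of_pow_le x hxI hI]; trivial
  obtain ⟨i, hi⟩ := Opens.mem_iSup.mp hp
  obtain ⟨ℓ, hℓ, hLℓ⟩ := hL i
  -- notation
  let B := Away (reesGrading I) (reesT (x i) (hxI i))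
  let j := affineBlowup.chartι (I := I) (x i) (hxI i)
  let K := (affineBlowup.idealSheaf L).comap (affineBlowup.π I)
  let ε : Γ(Spec (.of B), ⊤) ≅ CommRingCat.of B := Scheme.ΓSpecIso (.of B)
  -- the generator transported to `Γ(Spec B, ⊤)`
  let g₀ : Γ(Spec (.of B), ⊤) := ε.inv.hom ℓ
  have hg₀ : g₀ ∈ nonZeroDivisors _ :=
    mem_nonZeroDivisors_of_inverse ε.inv.hom ε.hom.hom (fun a => by
      change (ε.inv ≫ ε.hom).hom a = a; rw [ε.inv_hom_id]; rfl) (fun a => by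
      change (ε.hom ≫ ε.inv).hom a = a; rw [ε.hom_inv_id]; rfl) hℓ
  -- the top ideal of the pulled-back ideal sheaf on the chart
  have h2 : (K.comap j).ideal ⟨⊤, isAffineOpen_top _⟩ = Ideal.span {g₀} := by
    change (((affineBlowup.idealSheaf L).comap (affineBlowup.π I)).comap
      (affineBlowup.chartι (x i) (hxI i))).ideal ⟨⊤, isAffineOpen_top _⟩ = _
    rw [affineBlowup.comap_idealSheaf_comap_chartι, ideal_ofIdealTop_top, hLℓ, Ideal.map_span,
      Set.image_singleton]
  -- and upstairs through `Γ(Bl, j '' ⊤) ≅ Γ(Spec B, ⊤)`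
  let e : Γ(affineBlowup I, affineBlowup.chartOpen (I := I) (x i) (hxI i)) ≃+* Γ(Spec (.of B), ⊤) :=
    (j.appIso ⊤).commRingCatIsoToRingEquiv
  have h3 : ((K.ideal (affineBlowup.chartOpen (x i) (hxI i))).comap e.symm.toRingHom) = Ideal.span {g₀} := by
    rw [← h2]
    exact (Scheme.IdealSheafData.ideal_comap_of_isOpenImmersion K j ⟨⊤, isAffineOpen_top _⟩).symm
  refine ⟨affineBlowup.chartOpen (x i) (hxI i), ?_, e.symm g₀, ?_, ?_⟩
  · -- `p ∈ D₊(xᵢ t) = j '' ⊤`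
    change p ∈ affineBlowup.chartι (I := I) (x i) (hxI i) ''ᵁ ⊤
    rw [affineBlowup.image_top_chartι]
    exact hi
  · exact mem_nonZeroDivisors_of_inverse e.symm.toRingHom e.toRingHom
      (fun a => e.apply_symm_apply a) (fun a => e.symm_apply_apply a) hg₀
  · have : K.ideal (affineBlowup.chartOpen (x i) (hxI i)) =
        ((K.ideal (affineBlowup.chartOpen (x i) (hxI i))).comap e.symm.toRingHom).comap e.toRingHom := by
      rw [Ideal.comap_comap]
      convert (Ideal.comap_id _).symm
      ext a
      exact e.symm_apply_apply a
    rw [this, h3]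
    exact comap_span_singleton_ringEquiv e g₀

end Summit.ResolutionOfSingularities.ResolutionOfSingularities.Theorems.FRationalResolution.BlowupChartCartier

end
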